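import Mathlib
import Literature.Combinatorics.Optimization.RandomGapGraphs
import HarnessLib

/-!
# Random sparse multigraphs, V: the vertex-cover clause of the CMM gap graphs
# (every vertex cover is almost everything)

[topic Combinatorics/Optimization]

[CharikarMakarychevMakarychev2009] §5 (p. 10, last paragraph): "We will use random `∆`-regular graphs
in our integrality gap constructions. … It is known (see [1], [6], [18]) that for every `ε > 0` there
exists `∆` such that with high probability every cut in a random `∆`-regular graph cuts at most
`1/2 + ε` fraction of all edges **and every vertex cover contains at least `1 − ε` fraction of all
vertices**. Arora, Bollobás, Lovász, and Tourlakis [1] proved that with high probability we can remove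
`o(n)` edges from a random `∆`-regular graph so that every subgraph on `k` vertices is
`Ω(log(n/k))`-path decomposable".  The proof of Theorem 5.4 (Vertex Cover, p. 11–12) starts:
"Consider a graph `G = (V, E)` with maximum degree `∆` such that (i) every vertex cover contains at
least `1 − ε/6` fraction of all vertices; (2) every subgraph on `k` vertices is
`Ω(log(n/k))`-path decomposable."

`RandomGapGraphs.lean` (`RandomPairs.exists_gapGraphs`) built these graphs WITHOUT the vertex-cover
clause (recorded there as `-- TODO(general form): … the vertex-cover clause of p. 10`).  This file adds
it, inside the same finite model (the random pair multigraph `ω : Fin M → Fin n × Fin n`, `M = λn`,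
pruned of loops, high-degree incidences and short closed tuples, `RandomPairMultigraphPruned.lean`):

* `sum_exp_neg_inCount`, `sum_exp_neg_inCount_le`, `card_inCount_le_le` — the LOWER tail of the number
  `in_S(ω)` of sampled pairs inside `S × S` by the exponential-moment method with a negative
  exponent (`Σ_ω e^{−t·in_S} = ((n² − |S|²) + |S|² e^{−t})^M ≤ (n²)^M e^{−M(|S|/n)²(1−e^{−t})}`,
  Markov at `t = 1`);
* `card_exists_sparse_le`, `card_badIndep_le` — union bound over the `2ⁿ` vertex sets: the outcomes
  in which SOME `S` with `|S| ≥ εn` carries `≤ ε²M/4` sampled pairs number `≤ (n²)^M/8` once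
  `ε²λ ≥ 16`;
* `exists_good_vc` — a good outcome (the six events of `RandomPairs.Good`) which in addition has
  `in_S > ε₂²M/4` for every `S` with `|S| ≥ ε₂ n` (union bound, seven events of measure `≤ 1/8`);
* `exists_pruned_edge_of_dense` — deterministic: since fewer than `8λ + ε₁M/32 ≤ ε₂²M/4` indices are
  pruned, every such `S` still spans a pruned edge, i.e. **no independent set has `≥ ε₂ n` vertices /
  every vertex cover has more than `(1 − ε₂)n` vertices**;
* `exists_vcGapGraphs` — the CMM gap graphs with the vertex-cover clause: for every `ε > 0` there are
  `∆`, `c > 0`, `n₀` such that for all `n ≥ n₀` some loopless nonempty edge set on `n` vertices has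
  maximum degree `≤ ∆`, all cuts `≤ (1/2 + ε)|E|`, an edge inside every vertex set of size `≥ εn`, and
  all sub-edge-sets on `≤ √n` vertices `⌊c log n⌋`-path decomposable (parameters as in
  `exists_gapGraphs` with `ε₂ = min(ε, 1/4)`, `ε₁ = 4ε₂²`).

Everything is proved (finite sums); no named facts.  Consumed by `VertexCoverSheraliAdamsGap.lean`
(CMM09 Theorem 5.4).

## References

* [CharikarMakarychevMakarychev2009] M. Charikar, K. Makarychev, Y. Makarychev, *Integrality gaps for
  Sherali–Adams relaxations*, STOC 2009, 283–292, doi:10.1145/1536414.1536455; §5 p. 10 (last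
  paragraph), proof of Thm 5.4 (p. 11–12, item (i)).  Held text `paper:doi-10-1145-1536414-1536455`.
* [AroraBollobasLovaszTourlakis2006] S. Arora, B. Bollobás, L. Lovász, I. Tourlakis, *Proving
  integrality gaps without knowing the linear program*, Theory of Computing 2 (2006) 19–51, Lemma 2.8
  (p. 26–27: first moments with alterations; "almost surely, `G_{n,α/n}` has … no independent set of
  size larger than …" is the same union bound).
-/

noncomputable section

open Finset Real Filter Topology

namespace Literature.Combinatorics.Optimization

namespace RandomPairs

variable {n M : ℕ}

/-! ### Sampled pairs inside a vertex set: exponential moment and lower tail -/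

/-- **The exponential moment of the number of sampled pairs inside `S × S`** (negative exponent):
`Σ_ω e^{−t·in_S(ω)} = ((n² − |S × S|) + |S × S| e^{−t})^M`.
[cite: AroraBollobasLovaszTourlakis2006, Lemma 2.8 proof (p. 26–27)] -/
theorem sum_exp_neg_inCount (S : Finset (Fin n)) (t : ℝ) :
    ∑ ω : Fin M → Fin n × Fin n, exp (-(t * inCount S ω)) =
      (((n * n : ℕ) : ℝ) - (S ×ˢ S).card + (S ×ˢ S).card * exp (-t)) ^ M := by
  classical
  have hω : ∀ ω : Fin M → Fin n × Fin n, exp (-(t * inCount S ω)) =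
      ∏ i, exp (-t * if ω i ∈ S ×ˢ S then 1 else 0) := by
    intro ω
    rw [← Real.exp_sum]
    congr 1
    rw [inCount, Finset.card_filter]
    push_cast
    rw [Finset.mul_sum, ← Finset.sum_neg_distrib]
    exact Finset.sum_congr rfl fun i _ => by ring
  simp_rw [hω]
  rw [sum_prod_eq_pow (fun p : Fin n × Fin n => exp (-t * if p ∈ S ×ˢ S then 1 else 0))]
  congr 1
  rw [← Finset.sum_filter_add_sum_filter_not univ (fun p : Fin n × Fin n => p ∈ S ×ˢ S)]
  have hfil : univ.filter (fun p : Fin n × Fin n => p ∈ S ×ˢ S) = S ×ˢ S := by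
    ext p; simp
  have h1 : ∑ p ∈ univ.filter (fun p : Fin n × Fin n => p ∈ S ×ˢ S),
      exp (-t * if p ∈ S ×ˢ S then 1 else 0) = (S ×ˢ S).card * exp (-t) := by
    rw [Finset.sum_congr rfl fun p hp => by rw [if_pos (mem_filter.1 hp).2, mul_one], sum_const,
      nsmul_eq_mul, hfil]
  have h2 : ∑ p ∈ univ.filter (fun p : Fin n × Fin n => ¬ p ∈ S ×ˢ S),
      exp (-t * if p ∈ S ×ˢ S then 1 else 0) =
      ((univ.filter (fun p : Fin n × Fin n => ¬ p ∈ S ×ˢ S)).card : ℝ) := by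
    rw [Finset.sum_congr rfl fun p hp => by rw [if_neg (mem_filter.1 hp).2, mul_zero, exp_zero],
      sum_const, nsmul_eq_mul, mul_one]
  have hsplit : (univ.filter (fun p : Fin n × Fin n => p ∈ S ×ˢ S)).card +
      (univ.filter (fun p : Fin n × Fin n => ¬ p ∈ S ×ˢ S)).card = n * n := by
    rw [Finset.card_filter_add_card_filter_not, card_univ, Fintype.card_prod, Fintype.card_fin]
  rw [hfil] at hsplit
  rw [h1, h2]
  have : ((univ.filter (fun p : Fin n × Fin n => ¬ p ∈ S ×ˢ S)).card : ℝ) =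
      ((n * n : ℕ) : ℝ) - (S ×ˢ S).card := by
    rw [← hsplit]; push_cast; ring
  rw [this]; ring

/-- **Exponential moment bound**: `Σ_ω e^{−t·in_S(ω)} ≤ (n²)^M · e^{−M (|S|/n)² (1 − e^{−t})}` for
`t ≥ 0`, `n ≥ 1` (`1 − y ≤ e^{−y}`). [cite: AroraBollobasLovaszTourlakis2006, Lemma 2.8 proof (p. 26–27)] -/
theorem sum_exp_neg_inCount_le (S : Finset (Fin n)) (hn : 1 ≤ n) {t : ℝ} (ht : 0 ≤ t) :
    ∑ ω : Fin M → Fin n × Fin n, exp (-(t * inCount S ω)) ≤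
      ((n * n : ℕ) : ℝ) ^ M *
        exp (-(M * ((S.card : ℝ) ^ 2 / (n : ℝ) ^ 2 * (1 - exp (-t))))) := by
  rw [sum_exp_neg_inCount]
  set K : ℝ := ((S ×ˢ S).card : ℝ) with hK
  set N2 : ℝ := ((n * n : ℕ) : ℝ) with hN2
  have hn0 : (0 : ℝ) < n := by exact_mod_cast hn
  have hN2pos : 0 < N2 := by rw [hN2]; push_cast; positivity
  have hKeq : K = (S.card : ℝ) ^ 2 := by rw [hK, card_product]; push_cast; ring
  have hK0 : 0 ≤ K := by rw [hK]; exact Nat.cast_nonneg _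
  have hKle : K ≤ N2 := by
    rw [hK, hN2]
    have h := card_le_univ (S ×ˢ S)
    rw [Fintype.card_prod, Fintype.card_fin] at h
    exact_mod_cast h
  have het : exp (-t) ≤ 1 := Real.exp_le_one_iff.2 (by linarith)
  set p : ℝ := (S.card : ℝ) ^ 2 / (n : ℝ) ^ 2 with hp
  have hpK : K = N2 * p := by
    rw [hKeq, hp, hN2]; push_cast; field_simp
  have hbase : N2 - K + K * exp (-t) ≤ N2 * exp (-(p * (1 - exp (-t)))) := by
    have e : N2 - K + K * exp (-t) = N2 * (1 - p * (1 - exp (-t))) := by rw [hpK]; ring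
    rw [e]
    refine mul_le_mul_of_nonneg_left ?_ hN2pos.le
    have := Real.add_one_le_exp (-(p * (1 - exp (-t))))
    linarith
  have hbase0 : 0 ≤ N2 - K + K * exp (-t) := by nlinarith [exp_pos (-t)]
  calc (N2 - K + K * exp (-t)) ^ M ≤ (N2 * exp (-(p * (1 - exp (-t))))) ^ M :=
        pow_le_pow_left₀ hbase0 hbase M
    _ = N2 ^ M * exp (-(M * (p * (1 - exp (-t))))) := by
        rw [mul_pow, ← Real.exp_nat_mul]
        congr 2; ring

/-- **The lower tail (Chernoff)**: the outcomes with at most `a` sampled pairs inside `S × S` number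
at most `(n²)^M · e^{a − M(|S|/n)²/2}` (Markov on `e^{−in_S}`, `1 − e^{−1} ≥ 1/2`).
[cite: AroraBollobasLovaszTourlakis2006, Lemma 2.8 proof (p. 27: "by Markov's inequality")] -/
theorem card_inCount_le_le (S : Finset (Fin n)) (hn : 1 ≤ n) (a : ℝ) :
    ((((univ : Finset (Fin M → Fin n × Fin n)).filter fun ω => (inCount S ω : ℝ) ≤ a).card : ℝ)) ≤
      ((n * n : ℕ) : ℝ) ^ M * exp (a - M * ((S.card : ℝ) ^ 2 / (n : ℝ) ^ 2) / 2) := by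
  classical
  set p : ℝ := (S.card : ℝ) ^ 2 / (n : ℝ) ^ 2 with hp
  have hp0 : 0 ≤ p := by rw [hp]; positivity
  -- Markov on `e^{−in_S}` at level `e^{−a}`
  have hmarkov := card_filter_mul_le_sum
    (fun ω : Fin M → Fin n × Fin n => exp (-((1 : ℝ) * inCount S ω)))
    (fun _ => (exp_pos _).le) (exp (-a))
  have hset : (univ.filter fun ω : Fin M → Fin n × Fin n => (inCount S ω : ℝ) ≤ a) ⊆
      (univ.filter fun ω : Fin M → Fin n × Fin n => exp (-a) ≤ exp (-((1 : ℝ) * inCount S ω))) := by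
    intro ω hω
    refine mem_filter.2 ⟨mem_univ _, ?_⟩
    rw [Real.exp_le_exp, one_mul]
    exact neg_le_neg (mem_filter.1 hω).2
  have h1e : (1 : ℝ) / 2 ≤ 1 - exp (-1) := by
    have h := Real.add_one_le_exp (1 : ℝ)
    have hpos : 0 < exp (1 : ℝ) := exp_pos 1
    have hinv : exp (-1 : ℝ) ≤ 1 / 2 := by
      rw [Real.exp_neg, inv_eq_one_div, div_le_div_iff₀ hpos (by norm_num)]
      linarith
    linarith
  have hMp : 0 ≤ (M : ℝ) * p := by positivity
  have hle : ((((univ : Finset (Fin M → Fin n × Fin n)).filter fun ω =>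
        (inCount S ω : ℝ) ≤ a).card : ℝ)) * exp (-a) ≤
      ((n * n : ℕ) : ℝ) ^ M * exp (-(M * p / 2)) := by
    calc ((((univ : Finset (Fin M → Fin n × Fin n)).filter fun ω =>
            (inCount S ω : ℝ) ≤ a).card : ℝ)) * exp (-a)
        ≤ (((univ.filter fun ω : Fin M → Fin n × Fin n =>
            exp (-a) ≤ exp (-((1 : ℝ) * inCount S ω))).card : ℝ)) * exp (-a) := by
          gcongr
      _ ≤ ∑ ω : Fin M → Fin n × Fin n, exp (-((1 : ℝ) * inCount S ω)) := hmarkov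
      _ ≤ ((n * n : ℕ) : ℝ) ^ M * exp (-(M * (p * (1 - exp (-1))))) :=
          sum_exp_neg_inCount_le S hn zero_le_one
      _ ≤ ((n * n : ℕ) : ℝ) ^ M * exp (-(M * p / 2)) := by
          refine mul_le_mul_of_nonneg_left (Real.exp_le_exp.2 ?_) (by positivity)
          nlinarith
  have hexp : ((n * n : ℕ) : ℝ) ^ M * exp (-(M * p / 2)) =
      ((n * n : ℕ) : ℝ) ^ M * exp (a - M * p / 2) * exp (-a) := by
    rw [mul_assoc, ← Real.exp_add]; congr 2; ring
  rw [hexp] at hle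
  exact le_of_mul_le_mul_right hle (exp_pos _)

/-- **Union bound over the dense vertex sets**: the outcomes in which SOME `S` with `|S| ≥ εn`
carries at most `ε²M/4` sampled pairs number at most `2ⁿ (n²)^M e^{−ε²M/4}`.
[cite: CharikarMakarychevMakarychev2009, §5 (p. 10: "every vertex cover contains at least 1 − ε fraction of all vertices")] -/
theorem card_exists_sparse_le (hn : 1 ≤ n) {ε : ℝ} (hε : 0 ≤ ε) :
    ((((univ : Finset (Fin M → Fin n × Fin n)).filter fun ω =>
        ∃ S : Finset (Fin n), ε * n ≤ S.card ∧ (inCount S ω : ℝ) ≤ ε ^ 2 * M / 4).card : ℝ)) ≤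
      2 ^ n * (((n * n : ℕ) : ℝ) ^ M * exp (-(ε ^ 2 * M / 4))) := by
  classical
  set 𝒮 : Finset (Finset (Fin n)) := (univ : Finset (Fin n)).powerset.filter
    fun S => ε * n ≤ S.card with h𝒮
  have hsub : ((univ : Finset (Fin M → Fin n × Fin n)).filter fun ω =>
        ∃ S : Finset (Fin n), ε * n ≤ S.card ∧ (inCount S ω : ℝ) ≤ ε ^ 2 * M / 4) ⊆
      𝒮.biUnion fun S => univ.filter fun ω => (inCount S ω : ℝ) ≤ ε ^ 2 * M / 4 := by
    intro ω hω
    obtain ⟨S, hS, hin⟩ := (mem_filter.1 hω).2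
    exact mem_biUnion.2 ⟨S, mem_filter.2 ⟨mem_powerset.2 (subset_univ _), hS⟩,
      mem_filter.2 ⟨mem_univ _, hin⟩⟩
  have hn0 : (0 : ℝ) < n := by exact_mod_cast hn
  have hterm : ∀ S ∈ 𝒮, ((((univ : Finset (Fin M → Fin n × Fin n)).filter fun ω =>
        (inCount S ω : ℝ) ≤ ε ^ 2 * M / 4).card : ℝ)) ≤
      ((n * n : ℕ) : ℝ) ^ M * exp (-(ε ^ 2 * M / 4)) := by
    intro S hS
    have hSε : ε * n ≤ S.card := (mem_filter.1 hS).2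
    refine (card_inCount_le_le S hn _).trans (mul_le_mul_of_nonneg_left (Real.exp_le_exp.2 ?_)
      (by positivity))
    -- `(|S|/n)² ≥ ε²`
    have hp : ε ^ 2 ≤ (S.card : ℝ) ^ 2 / (n : ℝ) ^ 2 := by
      rw [le_div_iff₀ (by positivity)]
      calc ε ^ 2 * (n : ℝ) ^ 2 = (ε * n) ^ 2 := by ring
        _ ≤ (S.card : ℝ) ^ 2 := pow_le_pow_left₀ (by positivity) hSε 2
    have hM0 : (0 : ℝ) ≤ M := Nat.cast_nonneg _
    nlinarith
  calc ((((univ : Finset (Fin M → Fin n × Fin n)).filter fun ω =>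
          ∃ S : Finset (Fin n), ε * n ≤ S.card ∧ (inCount S ω : ℝ) ≤ ε ^ 2 * M / 4).card : ℝ))
      ≤ ((𝒮.biUnion fun S => univ.filter fun ω => (inCount S ω : ℝ) ≤ ε ^ 2 * M / 4).card : ℝ) := by
        exact_mod_cast card_le_card hsub
    _ ≤ ∑ S ∈ 𝒮, ((((univ : Finset (Fin M → Fin n × Fin n)).filter fun ω =>
          (inCount S ω : ℝ) ≤ ε ^ 2 * M / 4).card : ℝ)) := by
        exact_mod_cast card_biUnion_le
    _ ≤ ∑ S ∈ 𝒮, ((n * n : ℕ) : ℝ) ^ M * exp (-(ε ^ 2 * M / 4)) := sum_le_sum hterm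
    _ ≤ ∑ S ∈ (univ : Finset (Fin n)).powerset, ((n * n : ℕ) : ℝ) ^ M * exp (-(ε ^ 2 * M / 4)) :=
        sum_le_sum_of_subset_of_nonneg (filter_subset _ _) fun _ _ _ => by positivity
    _ = 2 ^ n * (((n * n : ℕ) : ℝ) ^ M * exp (-(ε ^ 2 * M / 4))) := by
        rw [sum_const, card_powerset, card_univ, Fintype.card_fin, nsmul_eq_mul]
        push_cast; ring

/-- (7) **Sparse dense sets are rare**: `≤ N/8` once `ε²λ ≥ 16` (`M = λn`, `n ≥ 2`).
[cite: CharikarMakarychevMakarychev2009, §5 (p. 10); AroraBollobasLovaszTourlakis2006, Lemma 2.8 proof (p. 26–27)] -/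
theorem card_badIndep_le {ε : ℝ} (hε : 0 ≤ ε) {lam : ℕ} (hn : 2 ≤ n) (hM : M = lam * n)
    (hlam16 : 16 ≤ ε ^ 2 * lam) :
    ((((univ : Finset (Fin M → Fin n × Fin n)).filter fun ω =>
        ∃ S : Finset (Fin n), ε * n ≤ S.card ∧ (inCount S ω : ℝ) ≤ ε ^ 2 * M / 4).card : ℝ)) ≤
      ((n * n : ℕ) : ℝ) ^ M / 8 := by
  set N : ℝ := ((n * n : ℕ) : ℝ) ^ M with hN
  have hNpos : 0 ≤ N := by rw [hN]; positivity
  have hMr : (M : ℝ) = lam * n := by rw [hM]; push_cast; ring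
  have hnpos : (0 : ℝ) ≤ n := Nat.cast_nonneg _
  refine (card_exists_sparse_le (n := n) (M := M) (by omega) hε).trans ?_
  rw [← hN]
  have hexp : exp (-(ε ^ 2 * M / 4)) ≤ exp (-(2 * n)) := by
    rw [exp_le_exp, hMr]
    have : (16 : ℝ) * n ≤ ε ^ 2 * lam * n := by nlinarith
    nlinarith
  have h2e : (2 : ℝ) * exp (-2) ≤ 3 / 10 := by
    have he : exp (1 : ℝ) > 2.7182818283 := exp_one_gt_d9
    have h22 : exp (2 : ℝ) = exp 1 * exp 1 := by rw [← exp_add]; norm_num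
    have h2 : exp (2 : ℝ) ≥ 20 / 3 := by rw [h22]; nlinarith
    rw [exp_neg, mul_inv_le_iff₀ (exp_pos _)]; linarith
  have hpow : (2 : ℝ) ^ n * exp (-(2 * n)) ≤ 1 / 8 := by
    have : (2 : ℝ) ^ n * exp (-(2 * n)) = (2 * exp (-2)) ^ n := by
      rw [mul_pow, ← Real.exp_nat_mul]; ring_nf
    rw [this]
    calc (2 * exp (-2) : ℝ) ^ n ≤ (3 / 10) ^ n := pow_le_pow_left₀ (by positivity) h2e n
      _ ≤ (3 / 10) ^ 2 := pow_le_pow_of_le_one (by norm_num) (by norm_num) hn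
      _ ≤ 1 / 8 := by norm_num
  calc (2 : ℝ) ^ n * (N * exp (-(ε ^ 2 * M / 4))) ≤ 2 ^ n * (N * exp (-(2 * n))) := by gcongr
    _ = (2 ^ n * exp (-(2 * n))) * N := by ring
    _ ≤ 1 / 8 * N := mul_le_mul_of_nonneg_right hpow hNpos
    _ = N / 8 := by ring

/-! ### A good outcome with no large sparse set -/

/-- **Union bound, seven events**: a `Good` outcome (`RandomGapGraphs`) exists which moreover has
more than `ε₂²M/4` sampled pairs inside every vertex set of size `≥ ε₂ n`, when each of the seven bad
events has at most `1/8` of the outcomes.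
[cite: AroraBollobasLovaszTourlakis2006, Lemma 2.8 proof (p. 26–27); CharikarMakarychevMakarychev2009, §5 (p. 10)] -/
theorem exists_good_vc {ε₁ ε₂ : ℝ} (hε₁ : 0 < ε₁) (hε₂ : 0 ≤ ε₂) {lam D l K : ℕ} {η : ℝ} (hn : 2 ≤ n)
    (hM : M = lam * n) (hlam : 1 ≤ lam) (hlam16 : 16 ≤ ε₁ ^ 2 * lam) (hlam16' : 16 ≤ ε₂ ^ 2 * lam)
    (hD : 512 * (2 + 4 * (lam : ℝ)) ≤ D * ε₁)
    (hcyc : 512 * ((l : ℝ) + 1) ^ 2 * (2 * lam) ^ l ≤ ε₁ * lam * n) (hlM : l ≤ M)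
    (hdense : (∑ W ∈ smallSets n K, (M.choose (rThr η W) *
        ((W.card * W.card) ^ (rThr η W) * (n * n) ^ (M - rThr η W)) : ℝ)) ≤
        ((n * n : ℕ) : ℝ) ^ M / 8) :
    ∃ ω : Fin M → Fin n × Fin n, Good ε₁ lam D l K η ω ∧
      ∀ S : Finset (Fin n), ε₂ * n ≤ S.card → ε₂ ^ 2 * M / 4 < (inCount S ω : ℝ) := by
  classical
  have h1 := card_badCut_le (n := n) hε₁ hn hM hlam16
  have h2 := card_badLoop_le (n := n) hn hM hlam
  have h3 := card_badRep_le (n := n) hn hM hlam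
  have h4 := card_badHigh_le (n := n) hε₁ hn hM hlam hD
  have h5 := card_badCyc_le (n := n) hε₁ hn hM hlam hcyc hlM
  have h6 := card_badDense_le (n := n) (M := M) (K := K) (η := η) hdense
  have h7 := card_badIndep_le (n := n) hε₂ hn hM hlam16'
  set B1 := (univ : Finset (Fin M → Fin n × Fin n)).filter fun ω =>
        ∃ x : Fin n → Bool, (1 / 2 + ε₁ / 4) * M ≤ (cutCount x ω : ℝ) with hB1
  set B2 := (univ : Finset (Fin M → Fin n × Fin n)).filter fun ω =>
    (8 * lam : ℝ) ≤ (loopCount ω : ℝ) with hB2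
  set B3 := (univ : Finset (Fin M → Fin n × Fin n)).filter fun ω =>
    (16 * (lam : ℝ) ^ 2) ≤ (repCount ω : ℝ) with hB3
  set B4 := (univ : Finset (Fin M → Fin n × Fin n)).filter fun ω =>
    ε₁ * M / 64 ≤ (highInc D ω : ℝ) with hB4
  set B5 := (univ : Finset (Fin M → Fin n × Fin n)).filter fun ω =>
    ε₁ * M / 64 ≤ ((cycIdx l ω).card : ℝ) with hB5
  set B6 := (univ : Finset (Fin M → Fin n × Fin n)).filter fun ω =>
        ∃ W ∈ smallSets n K, rThr η W ≤ inCount W ω with hB6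
  set B7 := (univ : Finset (Fin M → Fin n × Fin n)).filter fun ω =>
        ∃ S : Finset (Fin n), ε₂ * n ≤ S.card ∧ (inCount S ω : ℝ) ≤ ε₂ ^ 2 * M / 4 with hB7
  set B := B1 ∪ B2 ∪ B3 ∪ B4 ∪ B5 ∪ B6 ∪ B7 with hB
  have hN : ((n * n : ℕ) : ℝ) ^ M = Fintype.card (Fin M → Fin n × Fin n) := by
    rw [Fintype.card_fun, Fintype.card_prod, Fintype.card_fin, Fintype.card_fin]; push_cast; ring
  have hBcard : (B.card : ℝ) ≤
      B1.card + B2.card + B3.card + B4.card + B5.card + B6.card + B7.card := by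
    have e6 : (B.card : ℝ) ≤ (B1 ∪ B2 ∪ B3 ∪ B4 ∪ B5 ∪ B6).card + B7.card := by
      exact_mod_cast card_union_le _ _
    have e5 : ((B1 ∪ B2 ∪ B3 ∪ B4 ∪ B5 ∪ B6).card : ℝ) ≤ (B1 ∪ B2 ∪ B3 ∪ B4 ∪ B5).card + B6.card := by
      exact_mod_cast card_union_le _ _
    have e4 : ((B1 ∪ B2 ∪ B3 ∪ B4 ∪ B5).card : ℝ) ≤ (B1 ∪ B2 ∪ B3 ∪ B4).card + B5.card := by
      exact_mod_cast card_union_le _ _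
    have e3 : ((B1 ∪ B2 ∪ B3 ∪ B4).card : ℝ) ≤ (B1 ∪ B2 ∪ B3).card + B4.card := by
      exact_mod_cast card_union_le _ _
    have e2 : ((B1 ∪ B2 ∪ B3).card : ℝ) ≤ (B1 ∪ B2).card + B3.card := by
      exact_mod_cast card_union_le _ _
    have e1 : ((B1 ∪ B2).card : ℝ) ≤ B1.card + B2.card := by exact_mod_cast card_union_le _ _
    linarith
  have hNpos : (0 : ℝ) < ((n * n : ℕ) : ℝ) ^ M := by
    have : (0 : ℝ) < n := by exact_mod_cast (by omega : 0 < n)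
    positivity
  have hbad : (B.card : ℝ) < Fintype.card (Fin M → Fin n × Fin n) := by rw [← hN]; linarith
  have hlt : B.card < (univ : Finset (Fin M → Fin n × Fin n)).card := by
    rw [card_univ]; exact_mod_cast hbad
  obtain ⟨ω, -, hω⟩ := exists_mem_notMem_of_card_lt_card hlt
  have hω1 : ω ∉ B1 := fun h => hω (by
    rw [hB]; exact mem_union_left _ (mem_union_left _ (mem_union_left _ (mem_union_left _
      (mem_union_left _ (mem_union_left _ h))))))
  have hω2 : ω ∉ B2 := fun h => hω (by
    rw [hB]; exact mem_union_left _ (mem_union_left _ (mem_union_left _ (mem_union_left _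
      (mem_union_left _ (mem_union_right _ h))))))
  have hω3 : ω ∉ B3 := fun h => hω (by
    rw [hB]; exact mem_union_left _ (mem_union_left _ (mem_union_left _ (mem_union_left _
      (mem_union_right _ h)))))
  have hω4 : ω ∉ B4 := fun h => hω (by
    rw [hB]; exact mem_union_left _ (mem_union_left _ (mem_union_left _ (mem_union_right _ h))))
  have hω5 : ω ∉ B5 := fun h => hω (by
    rw [hB]; exact mem_union_left _ (mem_union_left _ (mem_union_right _ h)))
  have hω6 : ω ∉ B6 := fun h => hω (by rw [hB]; exact mem_union_left _ (mem_union_right _ h))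
  have hω7 : ω ∉ B7 := fun h => hω (by rw [hB]; exact mem_union_right _ h)
  refine ⟨ω, ⟨?_, ?_, ?_, ?_, ?_, ?_⟩, ?_⟩
  · intro x
    by_contra h; push Not at h
    exact hω1 (mem_filter.2 ⟨mem_univ _, x, h⟩)
  · by_contra h; push Not at h
    exact hω2 (mem_filter.2 ⟨mem_univ _, h⟩)
  · by_contra h; push Not at h
    exact hω3 (mem_filter.2 ⟨mem_univ _, h⟩)
  · by_contra h; push Not at h
    exact hω4 (mem_filter.2 ⟨mem_univ _, h⟩)
  · by_contra h; push Not at h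
    exact hω5 (mem_filter.2 ⟨mem_univ _, h⟩)
  · intro W hW
    by_contra h; push Not at h
    exact hω6 (mem_filter.2 ⟨mem_univ _, W, hW, h⟩)
  · intro S hS
    by_contra h; push Not at h
    exact hω7 (mem_filter.2 ⟨mem_univ _, S, hS, h⟩)

/-! ### The pruned graph has no large independent set -/

/-- **The vertex-cover clause, deterministically**: if the outcome is `Good` and carries more than
`ε₂²M/4` pairs inside every `S` with `|S| ≥ ε₂ n`, while `8λ + ε₁M/32 ≤ ε₂²M/4`, then — since fewer
than `8λ + ε₁M/64 + ε₁M/64` indices are pruned (loops, high-degree incidences, short closed tuples) —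
every such `S` contains both endpoints of a pruned edge: no independent set of the pruned graph has
`≥ ε₂ n` vertices, i.e. **every vertex cover has more than `(1 − ε₂)n` vertices**.
[cite: CharikarMakarychevMakarychev2009, §5 (p. 10: "every vertex cover contains at least 1 − ε fraction of all vertices") and proof of Thm 5.4 item (i) (p. 11)] -/
theorem exists_pruned_edge_of_dense {ε₁ ε₂ : ℝ} {lam D l K : ℕ} {η : ℝ}
    {ω : Fin M → Fin n × Fin n} (hω : Good ε₁ lam D l K η ω)
    (hω7 : ∀ S : Finset (Fin n), ε₂ * n ≤ S.card → ε₂ ^ 2 * M / 4 < (inCount S ω : ℝ))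
    (hthr : 8 * (lam : ℝ) + ε₁ * M / 32 ≤ ε₂ ^ 2 * M / 4)
    (S : Finset (Fin n)) (hS : ε₂ * n ≤ S.card) : ∃ e ∈ pruned D l ω, ∀ v ∈ e, v ∈ S := by
  classical
  obtain ⟨-, hloop, -, hhigh, hcyc, -⟩ := hω
  -- the indices inside `S × S` and the pruned indices
  set I := (univ : Finset (Fin M)).filter fun i => ω i ∈ S ×ˢ S with hI
  have hIcard : (I.card : ℝ) = inCount S ω := by rw [hI, inCount]
  set Bad := ((univ : Finset (Fin M)).filter fun i => (ω i).1 = (ω i).2) ∪ highIdx D ω ∪ cycIdx l ω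
    with hBad
  have hBadle : Bad.card ≤ loopCount ω + highInc D ω + (cycIdx l ω).card := by
    have e2 : Bad.card ≤ (((univ : Finset (Fin M)).filter fun i => (ω i).1 = (ω i).2) ∪
        highIdx D ω).card + (cycIdx l ω).card := card_union_le _ _
    have e1 : (((univ : Finset (Fin M)).filter fun i => (ω i).1 = (ω i).2) ∪ highIdx D ω).card ≤
        ((univ : Finset (Fin M)).filter fun i => (ω i).1 = (ω i).2).card + (highIdx D ω).card :=
      card_union_le _ _
    have e3 := card_highIdx_le D ω
    have e4 : ((univ : Finset (Fin M)).filter fun i => (ω i).1 = (ω i).2).card = loopCount ω := rfl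
    omega
  have hBadlt : (Bad.card : ℝ) < ε₂ ^ 2 * M / 4 := by
    have h1 : (Bad.card : ℝ) ≤ loopCount ω + highInc D ω + (cycIdx l ω).card := by
      exact_mod_cast hBadle
    linarith
  have hlt : Bad.card < I.card := by
    have : (Bad.card : ℝ) < I.card := by rw [hIcard]; exact hBadlt.trans (hω7 S hS)
    exact_mod_cast this
  obtain ⟨i, hiI, hiB⟩ := exists_mem_notMem_of_card_lt_card hlt
  -- `i` is kept
  have hik : i ∈ keep D l ω := by
    refine mem_filter.2 ⟨mem_univ _, fun h => hiB ?_, fun h => hiB ?_, fun h => hiB ?_⟩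
    · exact mem_union_left _ (mem_union_left _ (mem_filter.2 ⟨mem_univ _, h⟩))
    · exact mem_union_left _ (mem_union_right _ h)
    · exact mem_union_right _ h
  refine ⟨pairOf ω i, mem_pruned.2 ⟨i, hik, rfl⟩, fun v hv => ?_⟩
  have hp : ω i ∈ S ×ˢ S := (mem_filter.1 hiI).2
  rw [mem_product] at hp
  simp only [pairOf, Sym2.mem_iff] at hv
  rcases hv with rfl | rfl
  · exact hp.1
  · exact hp.2

/-! ### The gap graphs with the vertex-cover clause -/

set_option maxHeartbeats 800000 in
/-- **The CMM gap graphs with the vertex-cover clause.**  For every `ε > 0` there are `∆`, `c > 0`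
and `n₀` such that for all `n ≥ n₀` some loopless nonempty edge set `E` on `n` vertices has maximum
degree `≤ ∆`, all cuts `≤ (1/2+ε)|E|`, **an edge inside every vertex set of size `≥ εn`** (every
vertex cover has more than `(1 − ε)n` vertices), and all sub-edge-sets on `≤ √n` vertices
`⌊c log n⌋`-path decomposable.  Same construction and proof as `exists_gapGraphs`, with
`ε₂ = min(ε, 1/4)`, `ε₁ = 4ε₂²`, `λ = ⌈16/ε₁²⌉` random pairs per vertex, the seventh event of
`exists_good_vc`, and `exists_pruned_edge_of_dense` (which needs `64 ≤ ε₂² n`).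
[cite: CharikarMakarychevMakarychev2009, §5 (p. 10, last paragraph) and proof of Thm 5.4 items (i), (2) (p. 11–12); AroraBollobasLovaszTourlakis2006, Lemma 2.8 (p. 26–27) and Lemma 2.12] -/
theorem exists_vcGapGraphs :
    ∀ ε : ℝ, 0 < ε → ∃ Δ : ℕ, ∃ c : ℝ, 0 < c ∧ ∃ n₀ : ℕ, ∀ n : ℕ, n₀ ≤ n →
      ∃ E : Finset (Sym2 (Fin n)), E.Nonempty ∧ (∀ e ∈ E, ¬ e.IsDiag) ∧
        (∀ v : Fin n, (E.filter fun e => v ∈ e).card ≤ Δ) ∧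
        (∀ x : Fin n → Bool, ∑ e ∈ E, cutFn e x ≤ (1 / 2 + ε) * E.card) ∧
        (∀ S : Finset (Fin n), ε * n ≤ S.card → ∃ e ∈ E, ∀ v ∈ e, v ∈ S) ∧
        (∀ E' ⊆ E, ((Multicut.supp E').card : ℝ) ^ 2 ≤ n →
          Multicut.PathDecomposable ⌊c * Real.log n⌋₊ E') := by
  intro ε hε
  -- constants
  set ε₂ : ℝ := min ε (1 / 4) with hε₂
  have hε₂0 : 0 < ε₂ := lt_min hε (by norm_num)
  have hε₂4 : ε₂ ≤ 1 / 4 := min_le_right _ _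
  have hε₂ε : ε₂ ≤ ε := min_le_left _ _
  set ε₁ : ℝ := 4 * ε₂ ^ 2 with hε₁
  have hε₁0 : 0 < ε₁ := by rw [hε₁]; positivity
  have hε₁ε₂ : ε₁ ≤ ε₂ := by rw [hε₁]; nlinarith
  have hε₁1 : ε₁ ≤ 1 := by linarith
  have hε₁ε : ε₁ ≤ ε := hε₁ε₂.trans hε₂ε
  set lam : ℕ := ⌈16 / ε₁ ^ 2⌉₊ with hlamdef
  have hlam16 : 16 ≤ ε₁ ^ 2 * lam := by
    have h : 16 / ε₁ ^ 2 ≤ (lam : ℝ) := Nat.le_ceil _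
    have hε2 : 0 < ε₁ ^ 2 := by positivity
    calc (16 : ℝ) = ε₁ ^ 2 * (16 / ε₁ ^ 2) := by field_simp
      _ ≤ ε₁ ^ 2 * lam := mul_le_mul_of_nonneg_left h hε2.le
  have hlam16' : 16 ≤ ε₂ ^ 2 * lam := by
    have : ε₁ ^ 2 ≤ ε₂ ^ 2 := pow_le_pow_left₀ hε₁0.le hε₁ε₂ 2
    have : ε₁ ^ 2 * (lam : ℝ) ≤ ε₂ ^ 2 * lam := mul_le_mul_of_nonneg_right this (Nat.cast_nonneg _)
    linarith
  have hlam1r : (1 : ℝ) ≤ lam := by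
    have h1 : ε₁ ^ 2 ≤ 1 := by nlinarith
    have h2 : ε₁ ^ 2 * lam ≤ 1 * lam := mul_le_mul_of_nonneg_right h1 (Nat.cast_nonneg _)
    linarith
  have hlam : 1 ≤ lam := by exact_mod_cast hlam1r
  have hlam0 : (0 : ℝ) < lam := by linarith
  set D : ℕ := ⌈512 * (2 + 4 * (lam : ℝ)) / ε₁⌉₊ + 1 with hDdef
  have hD : 512 * (2 + 4 * (lam : ℝ)) ≤ D * ε₁ := by
    have h : 512 * (2 + 4 * (lam : ℝ)) / ε₁ ≤ (⌈512 * (2 + 4 * (lam : ℝ)) / ε₁⌉₊ : ℝ) := Nat.le_ceil _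
    have h' : (⌈512 * (2 + 4 * (lam : ℝ)) / ε₁⌉₊ : ℝ) ≤ D := by rw [hDdef]; push_cast; linarith
    calc 512 * (2 + 4 * (lam : ℝ)) = 512 * (2 + 4 * (lam : ℝ)) / ε₁ * ε₁ := by field_simp
      _ ≤ D * ε₁ := mul_le_mul_of_nonneg_right (h.trans h') hε₁0.le
  have hD1 : 1 ≤ D := by rw [hDdef]; omega
  set Bc : ℝ := exp 1 ^ 2 * lam with hBc
  set A : ℝ := Real.log (16 * Bc * (exp 1 * lam)) with hA
  have he1 : 1 ≤ exp (1 : ℝ) := by have := Real.add_one_le_exp (1:ℝ); linarith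
  have helam : 1 ≤ exp 1 * (lam : ℝ) := by nlinarith
  have hBc1 : 1 ≤ Bc := by rw [hBc]; nlinarith
  have hA0 : 0 ≤ A := by rw [hA]; exact Real.log_nonneg (by nlinarith)
  have hA2lam : Real.log (2 * lam) ≤ A := by
    rw [hA]; refine Real.log_le_log (by positivity) ?_; nlinarith
  set c : ℝ := 1 / (24 * (A + 1)) with hc
  have hc0 : 0 < c := by rw [hc]; positivity
  have hc1 : c ≤ 1 := by rw [hc, div_le_one (by positivity)]; linarith
  have hcA : c * Real.log (2 * lam) ≤ 1 / 4 := by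
    calc c * Real.log (2 * lam) ≤ c * A := mul_le_mul_of_nonneg_left hA2lam hc0.le
      _ = A / (24 * (A + 1)) := by rw [hc]; ring
      _ ≤ 1 / 4 := by rw [div_le_div_iff₀ (by positivity) (by norm_num)]; linarith
  refine ⟨D, c, hc0, ?_⟩
  -- eventual conditions in `n`
  have hnat : Tendsto (fun k : ℕ => (k : ℝ)) atTop atTop := tendsto_natCast_atTop_atTop
  have hlog : Tendsto (fun k : ℕ => Real.log (k : ℝ)) atTop atTop := Real.tendsto_log_atTop.comp hnat
  have ev1 : ∀ᶠ k : ℕ in atTop, 2 ≤ k := eventually_ge_atTop 2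
  have ev2 : ∀ᶠ k : ℕ in atTop, 32 * (8 * (lam : ℝ) + 16 * lam ^ 2) / (ε₁ * lam) ≤ (k : ℝ) :=
    hnat.eventually_ge_atTop _
  have ev3 : ∀ᶠ k : ℕ in atTop, (41472 / (ε₁ * lam)) ^ 2 ≤ (k : ℝ) := hnat.eventually_ge_atTop _
  have ev4 : ∀ᶠ k : ℕ in atTop, (exp 1 * lam) ^ 2 ≤ (k : ℝ) := hnat.eventually_ge_atTop _
  have ev5 : ∀ᶠ k : ℕ in atTop, 56 * A ≤ Real.log (k : ℝ) := hlog.eventually_ge_atTop _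
  have ev6 : ∀ᶠ k : ℕ in atTop, 64 / ε₂ ^ 2 ≤ (k : ℝ) := hnat.eventually_ge_atTop _
  obtain ⟨n₀, hn₀⟩ := eventually_atTop.1 (ev1.and (ev2.and (ev3.and (ev4.and (ev5.and ev6)))))
  refine ⟨n₀, fun n hn => ?_⟩
  obtain ⟨h2n, h2, h3, h4, h5, h6⟩ := hn₀ n hn
  have hn1 : 1 ≤ n := by omega
  have hnpos : (0 : ℝ) < n := by exact_mod_cast (by omega : 0 < n)
  have hn1r : (1 : ℝ) ≤ n := by exact_mod_cast hn1
  have hlogn0 : 0 ≤ Real.log n := Real.log_nonneg hn1r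
  -- `n`-dependent parameters
  set l : ℕ := ⌊c * Real.log n⌋₊ with hl
  set η : ℝ := 1 / (6 * l + 14) with hη
  set K : ℕ := ⌊Real.sqrt n⌋₊ with hK
  have hη0 : 0 ≤ η := by rw [hη]; positivity
  have hη1 : η ≤ 1 := by
    rw [hη, div_le_one (by positivity)]; have : (0:ℝ) ≤ l := Nat.cast_nonneg _; linarith
  have hlle : (l : ℝ) ≤ c * Real.log n := Nat.floor_le (mul_nonneg hc0.le hlogn0)
  have hsqrtpos : 0 < Real.sqrt n := Real.sqrt_pos.2 hnpos
  have hsq : Real.sqrt n * Real.sqrt n = n := Real.mul_self_sqrt hnpos.le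
  -- (a) `eλ ≤ √n`
  have hρ : exp 1 * lam ≤ Real.sqrt n := (Real.le_sqrt (by positivity) hnpos.le).2 h4
  -- (b) `32(8λ+16λ²) ≤ ε₁ λ n`
  have hsmall : 32 * (8 * (lam : ℝ) + 16 * lam ^ 2) ≤ ε₁ * ((lam * n : ℕ) : ℝ) := by
    push_cast
    have := (div_le_iff₀ (by positivity : (0:ℝ) < ε₁ * lam)).1 h2
    linarith
  -- (c) `512 (l+1)² (2λ)^l ≤ ε₁ λ n`
  have hcyc : 512 * ((l : ℝ) + 1) ^ 2 * (2 * lam) ^ l ≤ ε₁ * lam * n := by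
    have hn8 : 1 ≤ (n : ℝ) ^ (1 / 8 : ℝ) := Real.one_le_rpow hn1r (by norm_num)
    have hlog8 : Real.log n ≤ 8 * (n : ℝ) ^ (1 / 8 : ℝ) := by
      have := Real.log_le_rpow_div hnpos.le (by norm_num : (0:ℝ) < 1 / 8)
      linarith [show (n : ℝ) ^ (1 / 8 : ℝ) / (1 / 8) = 8 * (n : ℝ) ^ (1 / 8 : ℝ) by ring]
    have hl1 : (l : ℝ) + 1 ≤ 9 * (n : ℝ) ^ (1 / 8 : ℝ) := by
      have : (l : ℝ) ≤ Real.log n := hlle.trans (mul_le_of_le_one_left hlogn0 hc1)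
      linarith
    have hsq8 : ((n : ℝ) ^ (1 / 8 : ℝ)) ^ 2 = (n : ℝ) ^ (1 / 4 : ℝ) := by
      rw [← Real.rpow_natCast, ← Real.rpow_mul hnpos.le]; norm_num
    have hA1 : ((l : ℝ) + 1) ^ 2 ≤ 81 * (n : ℝ) ^ (1 / 4 : ℝ) := by
      calc ((l : ℝ) + 1) ^ 2 ≤ (9 * (n : ℝ) ^ (1 / 8 : ℝ)) ^ 2 :=
            pow_le_pow_left₀ (by positivity) hl1 2
        _ = 81 * (n : ℝ) ^ (1 / 4 : ℝ) := by rw [mul_pow, hsq8]; norm_num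
    have h2lam : (1 : ℝ) ≤ 2 * lam := by linarith
    have hB1 : (2 * (lam : ℝ)) ^ l ≤ (n : ℝ) ^ (1 / 4 : ℝ) := by
      calc (2 * (lam : ℝ)) ^ l = (2 * (lam : ℝ)) ^ ((l : ℕ) : ℝ) := (Real.rpow_natCast _ _).symm
        _ ≤ (2 * (lam : ℝ)) ^ (c * Real.log n) := Real.rpow_le_rpow_of_exponent_le h2lam hlle
        _ = Real.exp (c * Real.log n * Real.log (2 * lam)) := by
            rw [Real.rpow_def_of_pos (by positivity), mul_comm]
        _ ≤ Real.exp (Real.log n * (1 / 4)) := by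
            rw [Real.exp_le_exp]
            have : c * Real.log n * Real.log (2 * lam) = Real.log n * (c * Real.log (2 * lam)) := by
              ring
            rw [this]
            exact mul_le_mul_of_nonneg_left hcA hlogn0
        _ = (n : ℝ) ^ (1 / 4 : ℝ) := by rw [Real.rpow_def_of_pos hnpos]
    have hquarter : (n : ℝ) ^ (1 / 4 : ℝ) * (n : ℝ) ^ (1 / 4 : ℝ) = Real.sqrt n := by
      rw [← Real.rpow_add hnpos, Real.sqrt_eq_rpow]; norm_num
    have hsqrtge : 41472 / (ε₁ * lam) ≤ Real.sqrt n := (Real.le_sqrt (by positivity) hnpos.le).2 h3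
    have h41472 : 41472 * Real.sqrt n ≤ ε₁ * lam * n := by
      have := (div_le_iff₀ (by positivity : (0:ℝ) < ε₁ * lam)).1 hsqrtge
      calc 41472 * Real.sqrt n ≤ (Real.sqrt n * (ε₁ * lam)) * Real.sqrt n :=
            mul_le_mul_of_nonneg_right this hsqrtpos.le
        _ = ε₁ * lam * n := by rw [mul_comm (Real.sqrt n), mul_assoc, hsq]
    calc 512 * ((l : ℝ) + 1) ^ 2 * (2 * lam) ^ l
        ≤ 512 * (81 * (n : ℝ) ^ (1 / 4 : ℝ)) * (n : ℝ) ^ (1 / 4 : ℝ) := by gcongr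
      _ = 41472 * Real.sqrt n := by rw [← hquarter]; ring
      _ ≤ ε₁ * lam * n := h41472
  -- (d) `l ≤ M`
  have hlog_le : c * Real.log n ≤ Real.log n := mul_le_of_le_one_left hlogn0 hc1
  have hlM : l ≤ lam * n := by
    have h1 : (l : ℝ) ≤ Real.log n := hlle.trans hlog_le
    have h2' : Real.log n ≤ n := (Real.log_le_sub_one_of_pos hnpos).trans (by linarith)
    have h3' : (n : ℝ) ≤ lam * n := le_mul_of_one_le_left hnpos.le hlam1r
    exact_mod_cast (h1.trans (h2'.trans h3'))
  -- (e) the density decay: `e²λ ρ^η ≤ 1/16`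
  have hdecay : exp 1 ^ 2 * lam * (exp 1 * lam / Real.sqrt n) ^ η ≤ 1 / 16 := by
    have hρpos : 0 < exp 1 * lam / Real.sqrt n := by positivity
    have hηlog : A ≤ η / 2 * Real.log n := by
      have h12 : 12 * A * c ≤ 1 / 2 := by
        have hA1 : (0 : ℝ) < A + 1 := by linarith
        rw [hc, show 12 * A * (1 / (24 * (A + 1))) = A / (2 * (A + 1)) by field_simp; ring]
        rw [div_le_iff₀ (by positivity)]; linarith
      have hkey : 2 * A * (6 * c * Real.log n + 14) ≤ Real.log n := by
        have h' : 12 * A * c * Real.log n ≤ 1 / 2 * Real.log n :=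
          mul_le_mul_of_nonneg_right h12 hlogn0
        have e : 2 * A * (6 * c * Real.log n + 14) = 12 * A * c * Real.log n + 28 * A := by ring
        rw [e]; linarith
      have hden : (0 : ℝ) < 6 * l + 14 := by positivity
      rw [hη]
      rw [show 1 / (6 * (l : ℝ) + 14) / 2 * Real.log n = Real.log n / (2 * (6 * l + 14)) by
        field_simp]
      rw [le_div_iff₀ (by positivity)]
      calc A * (2 * (6 * (l : ℝ) + 14)) ≤ A * (2 * (6 * (c * Real.log n) + 14)) := by
            gcongr
        _ = 2 * A * (6 * c * Real.log n + 14) := by ring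
        _ ≤ Real.log n := hkey
    have hlogρ : Real.log (exp 1 * lam / Real.sqrt n) = Real.log (exp 1 * lam) - Real.log n / 2 := by
      rw [Real.log_div (by positivity) hsqrtpos.ne', Real.log_sqrt hnpos.le]
    have hexpr : exp 1 ^ 2 * lam * (exp 1 * lam / Real.sqrt n) ^ η =
        Real.exp (Real.log Bc + (Real.log (exp 1 * lam) - Real.log n / 2) * η) := by
      rw [Real.exp_add, Real.exp_log (by positivity), Real.rpow_def_of_pos hρpos, hlogρ, ← hBc]
    rw [hexpr]
    have h16 : (1 / 16 : ℝ) = Real.exp (-Real.log 16) := by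
      rw [Real.exp_neg, Real.exp_log (by norm_num)]; norm_num
    rw [h16, Real.exp_le_exp]
    have hAexp : A = Real.log 16 + Real.log Bc + Real.log (exp 1 * lam) := by
      rw [hA, Real.log_mul (by positivity) (by positivity), Real.log_mul (by norm_num) (by positivity)]
    have hlogel : 0 ≤ Real.log (exp 1 * lam) := Real.log_nonneg helam
    have : η * Real.log (exp 1 * lam) ≤ Real.log (exp 1 * lam) := mul_le_of_le_one_left hlogel hη1
    have e : Real.log Bc + (Real.log (exp 1 * lam) - Real.log n / 2) * η =
        Real.log Bc + η * Real.log (exp 1 * lam) - η / 2 * Real.log n := by ring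
    rw [e]; linarith
  -- (f) the vertex-cover threshold: `8λ + ε₁M/32 ≤ ε₂²M/4` from `64 ≤ ε₂² n`
  have hthr : 8 * (lam : ℝ) + ε₁ * ((lam * n : ℕ) : ℝ) / 32 ≤ ε₂ ^ 2 * ((lam * n : ℕ) : ℝ) / 4 := by
    push_cast
    have h64 : 64 ≤ ε₂ ^ 2 * n := by
      have := (div_le_iff₀ (by positivity : (0:ℝ) < ε₂ ^ 2)).1 h6
      linarith
    have : 64 * (lam : ℝ) ≤ ε₂ ^ 2 * n * lam := by nlinarith
    rw [hε₁]
    nlinarith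
  -- the good outcome and its pruned edge set
  have hKle : (K : ℝ) ≤ Real.sqrt n := Nat.floor_le hsqrtpos.le
  have hdense := dense_sum_le (M := lam * n) (K := K) hη0 rfl hn1 hlam hρ hKle hdecay
  obtain ⟨ω, hω, hω7⟩ := exists_good_vc (n := n) (M := lam * n) (K := K) (η := η) (D := D) (l := l)
    hε₁0 hε₂0.le h2n rfl hlam hlam16 hlam16' hD hcyc hlM hdense
  obtain ⟨hne, hloop, hdeg, hcut, hPD⟩ := good_props (ε := ε) hε₁0 hε₁1 hε₁ε rfl hn1 hlam hD1 hsmall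
    hη (by rw [hK]) hω
  refine ⟨pruned D l ω, hne, hloop, hdeg, hcut, fun S hS => ?_, hPD⟩
  refine exists_pruned_edge_of_dense hω hω7 hthr S (le_trans ?_ hS)
  exact mul_le_mul_of_nonneg_right hε₂ε hnpos.le

end RandomPairs

end Literature.Combinatorics.Optimization

end
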